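import Mathlib
import HarnessLib
import Summits.ResolutionOfSingularities.ResolutionOfSingularities.Theorems.WildQuotientsWildQuotientResolutionS1aInvariantsRegular
import Summits.ResolutionOfSingularities.ResolutionOfSingularities.Theorems.WildQuotientsWildQuotientResolutionS1aCoverNormalisation
import Summits.ResolutionOfSingularities.ResolutionOfSingularities.Theorems.WildQuotientsWildQuotientResolutionS1aLogExitFramesLocPrep
import Summits.ResolutionOfSingularities.ResolutionOfSingularities.Theorems.WildQuotientsWildQuotientResolutionS1aNodeReindex
import Summits.ResolutionOfSingularities.ResolutionOfSingularities.Theorems.WildQuotientsWildQuotientResolutionS1aNodeAtlas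

/-!
# S1a — (T2e, N4/N5) the INVARIANT NODE: the ring of invariants of a KILLED tame node is a (killed) tame node

[OURS · L1 W4.5c · lead-1 g7; T2E-BRIEF (N4)(N5)] — NOT statements of the manuscript; counted 0; AI-level work, weaker than expert
review. Crux stmt-ResolutionOfSingularities-17941, line `s1a-logminvertex` v6, stub `stub_winningStrategy` ((R0) branch).

For a graded ring `(B, 𝒜)` and a GRADED automorphism `σ` the ring of invariants `B^σ = invariantSubring σ` inherits the grading:
* `invPiece 𝒜 σ e` = `{x ∈ B^σ | x ∈ 𝒜 e}` (data), `invPiece_gradedMonoid`, `iSup_invPiece_eq_top`, `iSupIndep_invPiece`,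
  `isInternal_invPiece`, `invGradedRing` (data: `GradedRing (invPiece 𝒜 σ)` via `IsInternal.chooseDecomposition`);
* `finiteIndex_closure_nsmul` — `⟨p • s⟩` keeps finite index (f.g. abelian group of exponent `p` is finite);
* **`invariant_isTameNode`** — if `(B, 𝒜, σ)` is a tame node at the prime `p` (`ProducerStep.IsTameNode`) whose augmentation ideal is
  PRINCIPAL (the one-shot kill), and `B` is of finite type over a Noetherian ring `R₀` of `σ`-fixed degree-`0` elements, then
  `(B^σ, invPiece, 1)` is a tame node at `p` (KILLED: trivial automorphism): Noetherian + regular by the global Király–Lütkebohmert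
  theorem `isRegularRing_invariantSubring` (`…S1aInvariantsRegular`), (T1) by the `σ`-NORMS of the homogeneous units
  (`CoverNormalisation.sigmaNorm`, degrees `p • d`), (T2) by Noether/Artin–Tate finite generation over `R₀ ⊆ (B^σ)₀`;
* **(N5)** `isTameRootChart_invPiece_zero` — hence, for a node bigraded by `ℤ × Π j, ZMod (r j)` (a chart ring of the game), the
  DEGREE-ZERO INVARIANTS `(B^σ)₀ = (B₀)^σ` form a TAME ROOT CHART (`ProducerStep.isTameRootChart_degreeZero_of_isTameNode_prod`).
-/

set_option linter.dupNamespace false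

noncomputable section

open DirectSum Literature.AlgebraicGeometry.Resolution
open Summit.ResolutionOfSingularities.ResolutionOfSingularities.Theorems.WildQuotientResolution.S1.ProducerStep
open Summit.ResolutionOfSingularities.ResolutionOfSingularities.Theorems.WildQuotientResolution.S1.CoarseChart
open Summit.ResolutionOfSingularities.ResolutionOfSingularities.Theorems.WildQuotientResolution.S1.LogExitFrames

namespace Summit.ResolutionOfSingularities.ResolutionOfSingularities.Theorems.WildQuotientResolution.S1.InvariantsRegular

universe u v w

/-! ## A finite-index lemma -/

/-- If `⟨s⟩` has finite index in the abelian group `ι` then so has `⟨p • s⟩` (`0 < p`): the quotient `⟨s⟩ / ⟨p • s⟩` is a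
finitely generated abelian group of exponent `p`, hence finite. -/
theorem finiteIndex_closure_nsmul {ι : Type v} [AddCommGroup ι] [DecidableEq ι] (s : Finset ι)
    (hs : (AddSubgroup.closure (s : Set ι)).FiniteIndex) {p : ℕ} (hp : 0 < p) :
    (AddSubgroup.closure ((s.image (p • ·) : Finset ι) : Set ι)).FiniteIndex := by
  set H := AddSubgroup.closure (s : Set ι) with hH
  set K := AddSubgroup.closure ((s.image (p • ·) : Finset ι) : Set ι) with hK
  have hmemK : ∀ h ∈ H, p • h ∈ K := by
    intro h hh
    induction hh using AddSubgroup.closure_induction with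
    | mem x hx => exact AddSubgroup.subset_closure (Finset.mem_coe.mpr (Finset.mem_image.mpr ⟨x, hx, rfl⟩))
    | zero => rw [nsmul_zero]; exact K.zero_mem
    | add x y _ _ hx hy => rw [nsmul_add]; exact K.add_mem hx hy
    | neg x _ hx => rw [smul_neg]; exact K.neg_mem hx
  have hKH : K ≤ H := by
    rw [hK, AddSubgroup.closure_le]
    intro x hx
    obtain ⟨d, hd, rfl⟩ := Finset.mem_image.mp (Finset.mem_coe.mp hx)
    exact H.nsmul_mem (AddSubgroup.subset_closure hd) p
  haveI : AddGroup.FG H := (AddGroup.fg_iff_addSubgroup_fg H).mpr ⟨s, rfl⟩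
  haveI : AddGroup.FG (H ⧸ K.addSubgroupOf H) := QuotientAddGroup.fg _
  have htors : AddMonoid.IsTorsion (H ⧸ K.addSubgroupOf H) := by
    intro x
    induction x using QuotientAddGroup.induction_on with
    | H h =>
      refine isOfFinAddOrder_iff_nsmul_eq_zero.mpr ⟨p, hp, ?_⟩
      rw [← QuotientAddGroup.mk_nsmul, QuotientAddGroup.eq_zero_iff, AddSubgroup.mem_addSubgroupOf]
      exact hmemK _ h.2
  haveI : Finite (H ⧸ K.addSubgroupOf H) := AddCommGroup.finite_of_fg_torsion _ htors
  have h1 : (K.addSubgroupOf H).FiniteIndex := AddSubgroup.finiteIndex_of_finite_quotient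
  rw [AddSubgroup.finiteIndex_iff] at hs h1 ⊢
  rw [← AddSubgroup.relIndex_mul_index hKH]
  exact mul_ne_zero h1 hs

/-! ## The grading of the ring of invariants -/

section Pieces

variable {ι : Type v} {B : Type u} [CommRing B] (𝒜 : ι → AddSubgroup B) (σ : B ≃+* B)

/-- The `e`-th graded piece of the ring of invariants: invariants lying in `𝒜 e`. [OURS · L1 W4.5c] -/
def invPiece (e : ι) : AddSubgroup (invariantSubring σ) := (𝒜 e).comap (invariantSubring σ).subtype.toAddMonoidHom

/-- Membership in a piece is membership of the underlying element in `𝒜 e`. -/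
theorem mem_invPiece_iff {e : ι} {x : invariantSubring σ} : x ∈ invPiece 𝒜 σ e ↔ (x : B) ∈ 𝒜 e := Iff.rfl

end Pieces

section Grading

variable {ι : Type v} [AddCommGroup ι] [DecidableEq ι] {B : Type u} [CommRing B]
  (𝒜 : ι → AddSubgroup B) [GradedRing 𝒜] (σ : B ≃+* B)

/-- The pieces are multiplicative. -/
theorem invPiece_gradedMonoid : SetLike.GradedMonoid (invPiece 𝒜 σ) where
  one_mem := (mem_invPiece_iff 𝒜 σ).mpr (SetLike.GradedOne.one_mem (A := 𝒜))
  mul_mem _ _ _ _ hx hy := (mem_invPiece_iff 𝒜 σ).mpr (SetLike.GradedMul.mul_mem (A := 𝒜) hx hy)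

/-- For a GRADED `σ` the pieces exhaust the invariants: the components of an invariant are invariant. -/
theorem iSup_invPiece_eq_top (hσ : ∀ e : ι, ∀ b ∈ 𝒜 e, σ b ∈ 𝒜 e) : ⨆ e, invPiece 𝒜 σ e = ⊤ := by
  classical
  rw [eq_top_iff]
  rintro x -
  have hx : (x : invariantSubring σ) = ∑ e ∈ (decompose 𝒜 (x : B)).support,
      (⟨(decompose 𝒜 (x : B) e : B), coe_decompose_mem_invariantSubring 𝒜 σ hσ x.2 e⟩ : invariantSubring σ) := by
    apply Subtype.ext
    rw [AddSubmonoidClass.coe_finsetSum]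
    exact (sum_support_decompose 𝒜 (x : B)).symm
  rw [hx]
  exact AddSubgroup.sum_mem _ fun e _ => AddSubgroup.mem_iSup_of_mem e ((mem_invPiece_iff 𝒜 σ).mpr (decompose 𝒜 (x : B) e).2)

/-- The pieces are independent (they are independent in `B`). -/
theorem iSupIndep_invPiece : iSupIndep (invPiece 𝒜 σ) := by
  intro e
  rw [disjoint_iff_inf_le]
  rintro x ⟨hx₁, hx₂⟩
  have hind := (Decomposition.isInternal 𝒜).addSubgroup_iSupIndep e
  rw [disjoint_iff_inf_le] at hind
  have h2 : (x : B) ∈ ⨆ (j) (_ : j ≠ e), 𝒜 j := by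
    have hmap : (⨆ (j) (_ : j ≠ e), invPiece 𝒜 σ j).map (invariantSubring σ).subtype.toAddMonoidHom ≤
        ⨆ (j) (_ : j ≠ e), 𝒜 j := by
      rw [AddSubgroup.map_iSup]
      refine iSup_le fun j => ?_
      rw [AddSubgroup.map_iSup]
      refine iSup_le fun hj => ?_
      exact (AddSubgroup.map_comap_le _ _).trans (le_iSup₂ (f := fun j (_ : j ≠ e) => 𝒜 j) j hj)
    exact hmap ⟨x, hx₂, rfl⟩
  have := hind ⟨(mem_invPiece_iff 𝒜 σ).mp hx₁, h2⟩
  rw [AddSubgroup.mem_bot] at this ⊢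
  exact Subtype.ext this

/-- The decomposition of the invariants is internal. -/
theorem isInternal_invPiece (hσ : ∀ e : ι, ∀ b ∈ 𝒜 e, σ b ∈ 𝒜 e) : IsInternal (invPiece 𝒜 σ) := by
  classical
  refine ⟨(iSupIndep_invPiece 𝒜 σ).dfinsuppSumAddHom_injective, fun y => ?_⟩
  have hy : y ∈ ⨆ e, invPiece 𝒜 σ e := by rw [iSup_invPiece_eq_top 𝒜 σ hσ]; trivial
  refine AddSubgroup.iSup_induction (invPiece 𝒜 σ) (C := fun y => ∃ z, DirectSum.coeAddMonoidHom _ z = y)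
    hy (fun e y hy => ⟨DirectSum.of _ e ⟨y, hy⟩, DirectSum.coeAddMonoidHom_of _ _ _⟩) ⟨0, map_zero _⟩ ?_
  rintro _ _ ⟨z₁, rfl⟩ ⟨z₂, rfl⟩
  exact ⟨z₁ + z₂, map_add _ _ _⟩

/-- **The ring of invariants of a graded automorphism is a graded ring** with pieces `invPiece 𝒜 σ`. [OURS · L1 W4.5c] -/
@[implicit_reducible]
def invGradedRing (hσ : ∀ e : ι, ∀ b ∈ 𝒜 e, σ b ∈ 𝒜 e) : GradedRing (invPiece 𝒜 σ) :=
  { invPiece_gradedMonoid 𝒜 σ with toDecomposition := (isInternal_invPiece 𝒜 σ hσ).chooseDecomposition }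

/-- The degree-`0` invariants are the `σ`-fixed elements of `𝒜 0`, as a ring: `(B^σ)₀ ≃+* (B₀)^σ` where `(B₀)^σ` is cut out of
`𝒜 0` by `σ x = x`. (Identity on underlying elements.) [OURS · L1 W4.5c] -/
def invPieceZeroEquiv (hσ : ∀ e : ι, ∀ b ∈ 𝒜 e, σ b ∈ 𝒜 e) :
    letI := invGradedRing 𝒜 σ hσ
    ↥(invPiece 𝒜 σ 0) ≃+* ↥(RingHom.eqLocus
      (((σ : B →+* B).comp (SetLike.GradeZero.subring 𝒜).subtype).codRestrict (SetLike.GradeZero.subring 𝒜)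
        (fun x => hσ 0 x.1 x.2))
      (RingHom.id _)) :=
  letI := invGradedRing 𝒜 σ hσ
  { toFun := fun x => ⟨⟨(x : invariantSubring σ), x.2⟩, Subtype.ext x.1.2⟩
    invFun := fun x => ⟨⟨(x : ↥(SetLike.GradeZero.subring 𝒜)), congrArg Subtype.val x.2⟩, x.1.2⟩
    left_inv := fun _ => rfl
    right_inv := fun _ => rfl
    map_mul' := fun _ _ => rfl
    map_add' := fun _ _ => rfl }

end Grading

/-! ## The invariant node -/

section Node

variable {ι : Type v} [AddCommGroup ι] [DecidableEq ι] {B : Type u} [CommRing B]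
  (𝒜 : ι → AddSubgroup B) [GradedRing 𝒜] (σ : B ≃+* B)

/-- **THE INVARIANT NODE.** Let `(B, 𝒜, σ)` be a tame node at the prime `p` whose augmentation ideal is principal (a KILLED chart:
`…S1aOneShotKillChart(Shift)`), and let `B` be of finite type over a Noetherian ring `R₀` mapping to `σ`-fixed elements of degree
`0`. Then the ring of invariants with the inherited grading and the trivial automorphism is a tame node at `p`. [OURS · L1 W4.5c] -/
theorem invariant_isTameNode {p : ℕ} (hp : p.Prime) (hnode : IsTameNode p B 𝒜 σ) (hI : (augmentationIdeal σ).IsPrincipal)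
    {R₀ : Type w} [CommRing R₀] [IsNoetherianRing R₀] [Algebra R₀ B] [Algebra.FiniteType R₀ B]
    (hσ₀ : ∀ r : R₀, σ (algebraMap R₀ B r) = algebraMap R₀ B r) (h₀ : ∀ r : R₀, algebraMap R₀ B r ∈ 𝒜 0) :
    @IsTameNode p ι _ _ (invariantSubring σ) _ (invPiece 𝒜 σ) (invGradedRing 𝒜 σ hnode.2.2.2.2.1)
      (RingEquiv.refl _) := by
  obtain ⟨hN, hR, ⟨s, hs, hfin⟩, -, hσ𝒜, hσp⟩ := hnode
  letI := invGradedRing 𝒜 σ hσ𝒜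
  obtain ⟨hNA, t, ht, hgen⟩ := exists_finset_closure_of_finiteType σ hσ₀ hp.pos hσp
  haveI := hNA
  haveI := hR
  classical
  refine ⟨hNA, isRegularRing_invariantSubring σ hp hσp hI, ?_, ?_, fun _ _ h => h, fun b => ?_⟩
  · -- (T1): the σ-norms of the homogeneous units
    refine ⟨s.image (p • ·), fun d' hd' => ?_, finiteIndex_closure_nsmul s hfin hp.pos⟩
    obtain ⟨d, hd, rfl⟩ := Finset.mem_image.mp hd'
    obtain ⟨u, hu, hud⟩ := hs d hd
    refine ⟨⟨sigmaNorm σ p u, (mem_invariantSubring_iff σ _).mpr (sigma_sigmaNorm σ p hσp u)⟩, ?_,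
      (mem_invPiece_iff 𝒜 σ).mpr (sigmaNorm_mem 𝒜 σ p hσ𝒜 hud)⟩
    exact (isUnit_iff_coe_isUnit_invariantSubring σ _).mpr (isUnit_sigmaNorm σ p hu)
  · -- (T2): finite generation over the degree-0 invariants (Noether / Artin–Tate over `R₀ ⊆ (B^σ)₀`)
    let t' : Finset (invariantSubring σ) := t.attach.image (fun y => ⟨y.1, ht y.2⟩)
    refine ⟨t', ?_⟩
    rw [eq_top_iff]
    rintro x -
    have hx : (x : B) ∈ Subring.closure (Set.range (algebraMap R₀ B) ∪ ↑t) := hgen x.2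
    -- `range (algebraMap R₀ B) ∪ t` is the image of `invPiece 0 ∪ t'` under the inclusion
    have hsub : Set.range (algebraMap R₀ B) ∪ ↑t ⊆ (invariantSubring σ).subtype ''
        ((((invPiece 𝒜 σ 0 : AddSubgroup (invariantSubring σ)) : Set (invariantSubring σ)) ∪ ↑t')) := by
      rintro y (⟨r, rfl⟩ | hy)
      · exact ⟨⟨algebraMap R₀ B r, (mem_invariantSubring_iff σ _).mpr (hσ₀ r)⟩,
          Or.inl ((mem_invPiece_iff 𝒜 σ).mpr (h₀ r)), rfl⟩
      · exact ⟨⟨y, ht hy⟩, Or.inr (Finset.mem_coe.mpr (Finset.mem_image.mpr ⟨⟨y, hy⟩, Finset.mem_attach _ _, rfl⟩)), rfl⟩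
    have hx' := Subring.closure_mono hsub hx
    rw [← RingHom.map_closure] at hx'
    obtain ⟨y, hy, hyx⟩ := Subring.mem_map.mp hx'
    have : y = x := Subtype.ext hyx
    rwa [this] at hy
  · have h : ∀ n : ℕ, (⇑(RingEquiv.refl ↥(invariantSubring σ)))^[n] b = b := fun n => by
      induction n with
      | zero => rfl
      | succ n ih => rw [Function.iterate_succ_apply', ih]; rfl
    exact h p

/-- **(N5) THE DEGREE-ZERO INVARIANTS OF A KILLED CHART RING FORM A TAME ROOT CHART.** For a tame node bigraded by
`ℤ × Π j : Fin m, ZMod (r j)` (a chart ring of the game, `…S1aChartRingTameNode`) with principal augmentation ideal and of finite type over a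
Noetherian ring of `σ`-fixed degree-`0` elements, the ring `(B₀)^σ` of `σ`-fixed elements of `𝒜 0` is a tame root chart
(`S1.IsTameRootChart`). [OURS · L1 W4.5c] -/
theorem isTameRootChart_gradeZero_invariants {m : ℕ} (r : Fin m → ℕ)
    (𝒜 : (ℤ × (Π j : Fin m, ZMod (r j))) → AddSubgroup B) [GradedRing 𝒜] (σ : B ≃+* B)
    {p : ℕ} (hp : p.Prime) (hnode : IsTameNode p B 𝒜 σ) (hI : (augmentationIdeal σ).IsPrincipal)
    {R₀ : Type w} [CommRing R₀] [IsNoetherianRing R₀] [Algebra R₀ B] [Algebra.FiniteType R₀ B]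
    (hσ₀ : ∀ r : R₀, σ (algebraMap R₀ B r) = algebraMap R₀ B r) (h₀ : ∀ r : R₀, algebraMap R₀ B r ∈ 𝒜 0) :
    IsTameRootChart ↥(RingHom.eqLocus
      (((σ : B →+* B).comp (SetLike.GradeZero.subring 𝒜).subtype).codRestrict (SetLike.GradeZero.subring 𝒜)
        (fun x => hnode.2.2.2.2.1 0 x.1 x.2))
      (RingHom.id _)) := by
  letI := invGradedRing 𝒜 σ hnode.2.2.2.2.1
  have h := isTameRootChart_degreeZero_of_isTameNode_prod p r (invariantSubring σ) (invPiece 𝒜 σ) (RingEquiv.refl _)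
    (invariant_isTameNode 𝒜 σ hp hnode hI hσ₀ h₀)
  exact NodeAtlas.IsTameRootChart.of_ringEquiv (invPieceZeroEquiv 𝒜 σ hnode.2.2.2.2.1).symm h

/-- **(N5, `Π ZMod`-graded form)** the same for a node graded by `Π j : Fin m, ZMod (r j)` (any node chart of the game):
the `σ`-fixed part of `𝒜 0` is a tame root chart. [OURS · L1 W4.5c] -/
theorem isTameRootChart_gradeZero_invariants_pi {m : ℕ} (r : Fin m → ℕ)
    (𝒜 : (Π j : Fin m, ZMod (r j)) → AddSubgroup B) [GradedRing 𝒜] (σ : B ≃+* B)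
    {p : ℕ} (hp : p.Prime) (hnode : IsTameNode p B 𝒜 σ) (hI : (augmentationIdeal σ).IsPrincipal)
    {R₀ : Type w} [CommRing R₀] [IsNoetherianRing R₀] [Algebra R₀ B] [Algebra.FiniteType R₀ B]
    (hσ₀ : ∀ r : R₀, σ (algebraMap R₀ B r) = algebraMap R₀ B r) (h₀ : ∀ r : R₀, algebraMap R₀ B r ∈ 𝒜 0) :
    IsTameRootChart ↥(RingHom.eqLocus
      (((σ : B →+* B).comp (SetLike.GradeZero.subring 𝒜).subtype).codRestrict (SetLike.GradeZero.subring 𝒜)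
        (fun x => hnode.2.2.2.2.1 0 x.1 x.2))
      (RingHom.id _)) := by
  letI := invGradedRing 𝒜 σ hnode.2.2.2.2.1
  have h := isTameRootChart_degreeZero_of_isTameNode p r (invariantSubring σ) (invPiece 𝒜 σ) (RingEquiv.refl _)
    (invariant_isTameNode 𝒜 σ hp hnode hI hσ₀ h₀)
  exact NodeAtlas.IsTameRootChart.of_ringEquiv (invPieceZeroEquiv 𝒜 σ hnode.2.2.2.2.1).symm h

end Node

end Summit.ResolutionOfSingularities.ResolutionOfSingularities.Theorems.WildQuotientResolution.S1.InvariantsRegular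

end
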